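import Summits.Ventures.CertifiedManyBodySolver.Downfold.RouterWordScoreV8PreregG16

/-!
# Router-word score — v8 pre-registrations, g17: the ROUTER v0.7 «D3-occ» HOLD-OUT LEDGER and the director's KILL rule

[Provenance: director-hubbard g17 SIGNED 2026-08-29T00:21:22Z, conditions (1)–(5); hubbard-downfold-lead g20–g22 rulings
R-qo / R-qr / R-rk / R-rm and `router/PROSPECTIVE-v0.7.tsv` (opened 2026-08-29T01:12:02Z; rows 1–6 decided by 04:24Z);
hubbard-downfold-score-2 g16 hold-out pre-registration (cell STATUS 2026-08-29T00:24Z) and g17 PREREG §E 2026-08-29T04:2xZ.]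
[folklore] bookkeeping of ACCEPTANCE §4.2's router-word score (`RouterWordScore`); no physics, no certificate about a material.

ROUTER v0.7.0 put ONE gate in front of D3 (A11 «D3-occ»: a d site with crossing-set count k ≥ 3 and occupied d fraction
occ_d ≥ θ_occ = 0.90 is not a correlated candidate) and was adopted ON PROBATION. The lead's PROSPECTIVE LEDGER records, for
every d-site row boxed after T₀, the clause-silent v0.6.5 reading and the v0.7.0 word of record, each scored against the typed
truth, and files the row as (i) GAIN / (ii) LOSS / (iii) NEUTRAL — or VOID when the gate has no standing input (k < 3, D3 cannot
fire). The director's KILL RULE (condition (2)): among the FIRST TEN counted rows, two or more NEW DISAGREE attributable to the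
gate (the v0.6.5 reading scores AGREE or PARTIAL, the v0.7.0 word scores DISAGREE) ⇒ revert to v0.6.5 prospectively.
`RouterWordScoreV8PreregG16` §7 fixed the SIGN of the gate's score effect by the row's typing; this file types the ledger and
the rule and proves what score-2's hold-out lines assert in prose («the risk side is untestable by construction on these rows»):

* §1 objects — `Row` (typing, would-be d-head, k, occ, D3 bit), `Row.word065` / `Row.word070` (= G16's `d3Word` / `g2Word`
  once the D3 bit is read off the shares: `word065_eq_d3Word`, `word070_eq_g2Word`), `branchOf`, `newDisagreeOf`,
  `Row.branch`, `Row.newDisagree`, `Row.fragile`, `killCount` (first ten counted rows), `kill`, `tally` — total functions.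
* §2 THE KILL ROW HAS NO BARE «EPH» ALTERNATIVE — `no_newDisagree_of_eph_mem`: for ANY typing that lists «EPH» among its
  alternatives, any head, any k / occ / D3 bit, the row is never a new DISAGREE (gate open ⇒ the print is «EPH» ⇒ AGREE; gate
  shut ⇒ the two cells coincide); hence `killCount_eq_zero_of_eph_typed` / `kill_false_of_eph_typed`: on a queue whose every row
  types «EPH» the statistic is identically zero and the rule cannot fire, whatever the rows' number, order, heads or gate inputs.
  On an «EPH»-only row the branch is GAIN iff counted ∧ gate open ∧ D3 would have fired, else NEUTRAL / VOID, never LOSS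
  (`eph_row_branch`, `eph_row_never_loss`). The row shape that DOES feed the rule is the d-head-only typing on a firing site with
  an open gate (`dheadRow_kill_shape`: v0.6.5 AGREE → v0.7.0 DISAGREE, branch LOSS) — G16 §7's Ni-metal guard seen from the
  ledger; two such rows among the first ten counted fire the rule (`kill_of_two_dhead_rows`).
* §3 THE LEDGER OF RECORD AFTER ROW 6 (2026-08-29T04:24Z) — M410 BaPt₂Sb₂ VOID · M411 LaPt₂Si₂ NEUTRAL · M412 YPt₂Si₂ NEUTRAL ·
  M413 SrPt₂As₂ GAIN · M414 BaPt₂As₂ GAIN · M334 SrPtAs GAIN: `ledger0424_branches`, `ledger0424_tally` = (3, 0, 2, 1), counted 5,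
  `killCount = 0`, `kill = false`; FRAGILE flags by the letter; and `ledger0424_kill_false_append`: appending ANY further
  «EPH»-typed rows keeps `kill = false` — the first report at ten counted rows can only read KILL 0 unless a row typed without a
  bare «EPH» alternative (a correlated / ordered-d truth) enters the queue.
-/

namespace Summit.Ventures.CertifiedManyBodySolver.Downfold

namespace RouterScore

open Head

/-! ## §1 The ledger's objects -/

/-- Branch of a prospective row (lead R-qr (4) grammar): GAIN · LOSS · NEUTRAL; VOID = not counted. [folklore] -/
inductive Branch
  | GAIN | LOSS | NEUTRAL | VOID
  deriving DecidableEq, Repr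

/-- Rank of a score class for the two-router comparison: AGREE 2, PARTIAL 1, every other class 0. [folklore] -/
def rank : Outcome → ℕ
  | .AGREE => 2
  | .PARTIAL => 1
  | _ => 0

/-- Branch from the two cells (v0.6.5 reading, v0.7.0 word): GAIN iff the v0.7.0 cell ranks higher, LOSS iff lower, NEUTRAL
iff equal. [folklore] -/
def branchOf (o065 o070 : Outcome) : Branch :=
  if rank o065 < rank o070 then .GAIN else if rank o070 < rank o065 then .LOSS else .NEUTRAL

/-- NEW DISAGREE attributable to the gate (director condition (2)): the v0.7.0 cell is DISAGREE where the v0.6.5 cell was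
AGREE or PARTIAL. [folklore] -/
def newDisagreeOf (o065 o070 : Outcome) : Bool :=
  decide (o070 = .DISAGREE) && (decide (o065 = .AGREE) || decide (o065 = .PARTIAL))

/-- One prospective row in the one-site reading of G16 §6–§7: the typed truth `alts`; the d-head `h` that D3 prints when it
fires («UND:MIXED» straddle or «UND:MULTIORB» manifold head, by the box's own reading); the gate inputs `k` (crossing-set
count) and `occ` (occupied d fraction in thousandths — under ROUTER v0.7.2 the LOWER end of the like-for-like hull); and the D3
bit `fires` (would D3 fire on the site's shares), read off the box. [folklore] -/
structure Row where
  alts : List (List Head)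
  h : Head
  k : ℕ
  occ : ℕ
  fires : Bool
  deriving DecidableEq, Repr

/-- θ_occ of record in thousandths (ROUTER v0.7.0 A11). [folklore] -/
def thetaOcc : ℕ := 900

/-- The clause-silent v0.6.5 word of the row: the d-head over «EPH» if D3 fires, else «EPH». [folklore] -/
def Row.word065 (r : Row) : List Head := if r.fires then [r.h, eph] else [eph]

/-- The gate bit of the row (G16 `g2Open`: open iff k ≥ 3 ∧ occ ≥ θ_occ). [folklore] -/
def Row.gateOpen (θocc : ℕ) (r : Row) : Bool := g2Open θocc r.k r.occ

/-- The v0.7.0 word of the row: «EPH» if the gate is open (site not a candidate), else the v0.6.5 word. [folklore] -/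
def Row.word070 (θocc : ℕ) (r : Row) : List Head := if r.gateOpen θocc then [eph] else r.word065

/-- Counted rows: the gate has standing input (k ≥ 3). The ledger's VOID rows are the k < 3 rows (M410 BaPt₂Sb₂, k 0: no
crossing set reaches θ_d, D3 cannot fire, no word passes through A11). [folklore] -/
def Row.counted (r : Row) : Bool := decide (3 ≤ r.k)

/-- The v0.6.5 cell of the row. [folklore] -/
def Row.cell065 (r : Row) : Outcome := score r.word065 r.alts

/-- The v0.7.0 cell of the row. [folklore] -/
def Row.cell070 (θocc : ℕ) (r : Row) : Outcome := score (r.word070 θocc) r.alts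

/-- The row's branch: VOID if not counted, else `branchOf` the two cells. [folklore] -/
def Row.branch (θocc : ℕ) (r : Row) : Branch :=
  if r.counted then branchOf r.cell065 (r.cell070 θocc) else .VOID

/-- The row's KILL bit: counted AND a new DISAGREE. [folklore] -/
def Row.newDisagree (θocc : ℕ) (r : Row) : Bool := r.counted && newDisagreeOf r.cell065 (r.cell070 θocc)

/-- FRAGILE(D3-occ) by the letter (lead R-qo (3)): |occ − θ_occ| ≤ 0.010. [folklore] -/
def Row.fragile (θocc : ℕ) (r : Row) : Bool := decide (θocc ≤ r.occ + 10) && decide (r.occ ≤ θocc + 10)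

/-- The KILL statistic: new DISAGREEs among the first ten COUNTED rows, in ledger order. [folklore] -/
def killCount (θocc : ℕ) (rows : List Row) : ℕ :=
  (((rows.filter Row.counted).take 10).filter (Row.newDisagree θocc)).length

/-- The director's KILL rule (condition (2)): revert iff the statistic reaches two. [folklore] -/
def kill (θocc : ℕ) (rows : List Row) : Bool := decide (2 ≤ killCount θocc rows)

/-- The number of counted rows so far (the first report is due at ten). [folklore] -/
def countedSoFar (rows : List Row) : ℕ := (rows.filter Row.counted).length

/-- Tally (gains, losses, neutral, void) over the ledger. [folklore] -/
def tally (θocc : ℕ) (rows : List Row) : ℕ × ℕ × ℕ × ℕ :=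
  ((rows.filter fun r => r.branch θocc = .GAIN).length, (rows.filter fun r => r.branch θocc = .LOSS).length,
   (rows.filter fun r => r.branch θocc = .NEUTRAL).length, (rows.filter fun r => r.branch θocc = .VOID).length)

/-- Bridge to G16 §6: with the D3 bit read off the shares at θ_d, the row's v0.6.5 word IS `d3Word`. [folklore] -/
theorem word065_eq_d3Word (r : Row) (θ : ℕ) (shares : List ℕ) (hf : r.fires = d3Fires θ shares) :
    r.word065 = d3Word r.h θ shares := by
  unfold Row.word065 d3Word; rw [hf]

/-- Bridge to G16 §7: likewise the row's v0.7.0 word IS `g2Word`. [folklore] -/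
theorem word070_eq_g2Word (r : Row) (θocc θ : ℕ) (shares : List ℕ) (hf : r.fires = d3Fires θ shares) :
    r.word070 θocc = g2Word r.h θocc r.k r.occ θ shares := by
  unfold Row.word070 Row.gateOpen g2Word; rw [word065_eq_d3Word r θ shares hf]

/-! ## §2 Which rows can feed the KILL rule -/

/-- A bare «EPH» print against a typing that lists «EPH» is AGREE. [folklore] -/
theorem score_eph_of_mem {alts : List (List Head)} (h : [eph] ∈ alts) : score [eph] alts = .AGREE := by
  have hne : alts ≠ [] := List.ne_nil_of_mem h
  rw [score, outcome_eq_agree_iff Head.structural hne (by simp [Head.structural])]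
  exact ⟨[eph], h, by decide⟩

/-- THE KILL ROW HAS NO BARE «EPH» ALTERNATIVE. For ANY typing, head, gate inputs and D3 bit: if «EPH» is one of the typed
alternatives the row is never a new DISAGREE — gate open ⇒ the v0.7.0 print is «EPH» ⇒ AGREE; gate shut ⇒ the v0.7.0 word is
the v0.6.5 word and the two cells coincide. (Every prospective truth so far — the Pt-5d quintet, SrPtAs — types «EPH».)
[folklore] -/
theorem no_newDisagree_of_eph_mem (θocc : ℕ) (r : Row) (h : [eph] ∈ r.alts) : r.newDisagree θocc = false := by
  have key : newDisagreeOf r.cell065 (r.cell070 θocc) = false := by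
    unfold newDisagreeOf Row.cell070 Row.word070 Row.cell065
    split
    · rw [score_eph_of_mem h]; simp
    · generalize score r.word065 r.alts = o; cases o <;> decide
  unfold Row.newDisagree; rw [key, Bool.and_false]

/-- Contrapositive: a row that feeds the KILL statistic is typed WITHOUT a bare «EPH» alternative (a correlated / ordered-d
truth such as «UND:MULTIORB | UND:MULTIORB+EPH»). [folklore] -/
theorem eph_not_mem_of_newDisagree (θocc : ℕ) (r : Row) (h : r.newDisagree θocc = true) : [eph] ∉ r.alts := by
  intro hm; rw [no_newDisagree_of_eph_mem θocc r hm] at h; exact Bool.false_ne_true h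

/-- ON A QUEUE WHOSE EVERY ROW TYPES «EPH» THE KILL STATISTIC IS ZERO — whatever the heads, gate inputs, D3 bits, order or
length. «The risk side is untestable by construction on these rows.» [folklore] -/
theorem killCount_eq_zero_of_eph_typed (θocc : ℕ) (rows : List Row) (h : ∀ r ∈ rows, [eph] ∈ r.alts) :
    killCount θocc rows = 0 := by
  unfold killCount
  rw [List.length_eq_zero_iff, List.filter_eq_nil_iff]
  intro r hr
  have hr' : r ∈ rows := (List.mem_filter.1 (List.mem_of_mem_take hr)).1
  simp [no_newDisagree_of_eph_mem θocc r (h r hr')]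

/-- … AND THE RULE CANNOT FIRE. [folklore] -/
theorem kill_false_of_eph_typed (θocc : ℕ) (rows : List Row) (h : ∀ r ∈ rows, [eph] ∈ r.alts) :
    kill θocc rows = false := by
  unfold kill; rw [killCount_eq_zero_of_eph_typed θocc rows h]; decide

/-- On a row typed «EPH» ONLY, with either router d-head: the branch is GAIN iff the row is counted, the gate is open and D3
would have fired (v0.6.5 PARTIAL → v0.7.0 AGREE); otherwise NEUTRAL (counted) or VOID. [folklore] -/
theorem eph_row_branch (θocc : ℕ) (r : Row) (ha : r.alts = [[eph]]) (hh : r.h = undMixed ∨ r.h = undMultiorb) :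
    r.branch θocc = (if r.counted then (if r.gateOpen θocc && r.fires then .GAIN else .NEUTRAL) else .VOID) := by
  unfold Row.branch branchOf Row.cell065 Row.cell070 Row.word070 Row.word065
  rw [ha]
  generalize r.counted = c; generalize r.gateOpen θocc = g; generalize r.fires = f
  rcases hh with hh | hh <;> rw [hh] <;> cases c <;> cases g <;> cases f <;> decide

/-- … in particular never LOSS. [folklore] -/
theorem eph_row_never_loss (θocc : ℕ) (r : Row) (ha : r.alts = [[eph]]) (hh : r.h = undMixed ∨ r.h = undMultiorb) :
    r.branch θocc ≠ .LOSS := by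
  rw [eph_row_branch θocc r ha hh]
  generalize r.counted = c; generalize (r.gateOpen θocc && r.fires) = b
  cases c <;> cases b <;> decide

/-- The row shape that DOES feed the rule: typed with the d-head only («UND:MULTIORB | UND:MULTIORB+EPH», the ordered-3d
control letter of Ni metal M165 / Cr / CrAs-AFM / the 1111 ferromagnets), D3 firing with the manifold head. [folklore] -/
def dheadRow (k occ : ℕ) : Row := ⟨[[undMultiorb], [undMultiorb, eph]], undMultiorb, k, occ, true⟩

/-- THE KILL SHAPE: on `dheadRow` with an open gate (k ≥ 3 ∧ occ ≥ θ_occ) the v0.6.5 cell is AGREE, the v0.7.0 cell DISAGREE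
(«EPH» carries no typed primary — the no-primary floor of G15 §1), so the row is a new DISAGREE and files as LOSS. This is G16
§7's Ni-metal guard seen from the ledger: were θ_occ ≤ 0.871, Ni metal (k 5, occ 0.871) would be such a row. [folklore] -/
theorem dheadRow_kill_shape (θocc k occ : ℕ) (hk : 3 ≤ k) (hocc : θocc ≤ occ) :
    (dheadRow k occ).cell065 = .AGREE ∧ (dheadRow k occ).cell070 θocc = .DISAGREE
    ∧ (dheadRow k occ).newDisagree θocc = true ∧ (dheadRow k occ).branch θocc = .LOSS := by
  have hg : (dheadRow k occ).gateOpen θocc = true := by simp [Row.gateOpen, g2Open, dheadRow, hk, hocc]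
  have hc : (dheadRow k occ).counted = true := by simp [Row.counted, dheadRow, hk]
  have h65 : (dheadRow k occ).cell065 = .AGREE := by
    show score [undMultiorb, eph] [[undMultiorb], [undMultiorb, eph]] = .AGREE; decide
  have h70 : (dheadRow k occ).cell070 θocc = .DISAGREE := by
    unfold Row.cell070 Row.word070; rw [hg, if_pos rfl]
    show score [eph] [[undMultiorb], [undMultiorb, eph]] = .DISAGREE; decide
  refine ⟨h65, h70, ?_, ?_⟩
  · unfold Row.newDisagree; rw [hc, h65, h70]; decide
  · unfold Row.branch; rw [hc, h65, h70]; decide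

/-- With the gate SHUT (occ < θ_occ — Ni metal at the θ_occ of record) the same row is NEUTRAL and feeds nothing. [folklore] -/
theorem dheadRow_shut_neutral (θocc k occ : ℕ) (hk : 3 ≤ k) (hocc : occ < θocc) :
    (dheadRow k occ).newDisagree θocc = false ∧ (dheadRow k occ).branch θocc = .NEUTRAL := by
  have hg : (dheadRow k occ).gateOpen θocc = false := by
    simp [Row.gateOpen, g2Open, dheadRow, hocc]
  have hc : (dheadRow k occ).counted = true := by simp [Row.counted, dheadRow, hk]
  have h65 : (dheadRow k occ).cell065 = .AGREE := by
    show score [undMultiorb, eph] [[undMultiorb], [undMultiorb, eph]] = .AGREE; decide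
  have h70 : (dheadRow k occ).cell070 θocc = .AGREE := by
    unfold Row.cell070 Row.word070; rw [hg]
    show score (if false = true then [eph] else (dheadRow k occ).word065) _ = _
    rw [if_neg Bool.false_ne_true]; exact h65
  constructor
  · unfold Row.newDisagree; rw [hc, h65, h70]; decide
  · unfold Row.branch; rw [hc, h65, h70]; decide

/-- TWO kill-shape rows among the first ten counted rows fire the rule (the statistic counts them wherever «EPH»-typed rows
sit around them). Instance: two open-gate d-head rows after the six rows of record (§3) ⇒ `kill = true`. [folklore] -/
theorem kill_of_two_dhead_rows :
    kill thetaOcc [dheadRow 5 913, dheadRow 5 920] = true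
    ∧ killCount thetaOcc [dheadRow 5 913, ⟨[[eph]], undMixed, 5, 911, true⟩, dheadRow 5 871, dheadRow 5 920] = 2 := by
  decide

/-! ## §3 The ledger of record after row 6 (router/PROSPECTIVE-v0.7.tsv, 2026-08-29T04:24Z)

Occupancies in thousandths (nearest; for M412 the LOWER end of the like-for-like hull per ROUTER v0.7.2, for M414 the table
of record). The d-head is the R3c straddle «UND:MIXED» on all six (the v0.6.5 reading printed «UND:MIXED+EPH» on the five
firing rows). Typings as in the truth files: «EPH» (M410, M412, M334) or «EPH | EPH+UND:STRUCT» (M411, M413, M414). -/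

/-- Row 1 — M410 BaPt₂Sb₂ @0: k 0 (max w_d 0.32 < θ_d, D3 silent), occ 0.921 complete ⇒ VOID. [folklore] -/
def rowM410 : Row := ⟨[[eph]], undMixed, 0, 921, false⟩
/-- Row 2 — M411 LaPt₂Si₂ @0: k 5, occ 0.8968 COMPLETE (v2 record) < θ_occ ⇒ gate shut ⇒ «UND:MIXED+EPH» both ways ⇒
NEUTRAL (was GAIN as first printed on the truncated 0.944). [folklore] -/
def rowM411 : Row := ⟨[[eph], [eph, undStruct]], undMixed, 5, 897, true⟩
/-- Row 3 — M412 YPt₂Si₂ @0: k 5, like-for-like hull [0.8994, 0.9015] STRADDLES θ_occ ⇒ interval reading (R-rk / R-rm,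
v0.7.2): gate shut (lower end 0.899) ⇒ straddle word both ways ⇒ NEUTRAL. (The v2 print leads with the annotation head
«UND:MIXED(d_occ_frac straddles θ_occ)» before «UND:MIXED+EPH» — same class, PARTIAL.) [folklore] -/
def rowM412 : Row := ⟨[[eph]], undMixed, 5, 899, true⟩
/-- Row 4 — M413 SrPt₂As₂ @0: k 5, occ 0.903 COMPLETE ≥ θ_occ ⇒ gate open ⇒ «EPH» AGREE vs v0.6.5 «UND:MIXED+EPH» PARTIAL ⇒
GAIN, FRAGILE (0.003 inside). [folklore] -/
def rowM413 : Row := ⟨[[eph], [eph, undStruct]], undMixed, 5, 903, true⟩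
/-- Row 5 — M414 BaPt₂As₂ @0: k 5, occ 0.9119 (table of record; INFL-PP twin 0.9084 printed beside) ⇒ gate open on both
tables ⇒ GAIN; by the letter not FRAGILE at 0.912, the ledger's flag rides on the INFL-PP hull-lo 0.908. [folklore] -/
def rowM414 : Row := ⟨[[eph], [eph, undStruct]], undMixed, 5, 912, true⟩
/-- Row 6 — M334 SrPtAs @0 (the first R-rl (a) prospective-first row): k 5 (D3 on sheet 32 only, 68 % weight), occ 0.911
COMPLETE at birth ⇒ gate open ⇒ GAIN; NOT FRAGILE by one thousandth (0.011 > 0.010; the win10 datum 0.907 would be).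
[folklore] -/
def rowM334 : Row := ⟨[[eph]], undMixed, 5, 911, true⟩

/-- The ledger after row 6, in ledger order. [folklore] -/
def ledger0424 : List Row := [rowM410, rowM411, rowM412, rowM413, rowM414, rowM334]

/-- The two cells per row (v0.6.5, v0.7.0) as the ledger prints them: AGREE/AGREE · PARTIAL/PARTIAL · PARTIAL/PARTIAL ·
PARTIAL/AGREE · PARTIAL/AGREE · PARTIAL/AGREE. [folklore] -/
theorem ledger0424_cells :
    ledger0424.map (fun r => (r.cell065, r.cell070 thetaOcc))
      = [(.AGREE, .AGREE), (.PARTIAL, .PARTIAL), (.PARTIAL, .PARTIAL), (.PARTIAL, .AGREE), (.PARTIAL, .AGREE),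
         (.PARTIAL, .AGREE)] := by
  decide

/-- Branches of record: VOID · NEUTRAL · NEUTRAL · GAIN · GAIN · GAIN. [folklore] -/
theorem ledger0424_branches :
    ledger0424.map (Row.branch thetaOcc) = [.VOID, .NEUTRAL, .NEUTRAL, .GAIN, .GAIN, .GAIN] := by decide

/-- The hold-out statistic after row 6: gains 3 · losses 0 · neutral 2 · void 1; counted 5 of the ten the first report
needs; KILL statistic 0; the rule does not fire («GAIN ×3 + NEUTRAL ×2 + VOID ×1, KILL 0/5», lead 2026-08-29T04:18:53Z;
score-2 hold-out line 04:20Z). [folklore] -/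
theorem ledger0424_tally :
    tally thetaOcc ledger0424 = (3, 0, 2, 1) ∧ countedSoFar ledger0424 = 5
    ∧ killCount thetaOcc ledger0424 = 0 ∧ kill thetaOcc ledger0424 = false := by
  decide

/-- FRAGILE(D3-occ) by the letter on the occupancies carried here: M410 no · M411 yes (0.003 below) · M412 yes (hull at θ) ·
M413 yes · M414 no at the table of record 0.912 (yes at the INFL-PP hull-lo 0.908, the ledger's flag) · M334 no at 0.911 (yes
at the win10 datum 0.907, printed not scored). [folklore] -/
theorem ledger0424_fragile :
    ledger0424.map (Row.fragile thetaOcc) = [false, true, true, true, false, false]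
    ∧ Row.fragile thetaOcc ⟨[[eph], [eph, undStruct]], undMixed, 5, 908, true⟩ = true
    ∧ Row.fragile thetaOcc ⟨[[eph]], undMixed, 5, 907, true⟩ = true := by
  decide

/-- Every row of the ledger types a bare «EPH» alternative. [folklore] -/
theorem ledger0424_eph_typed : ∀ r ∈ ledger0424, [eph] ∈ r.alts := by decide

/-- WHATEVER «EPH»-TYPED ROWS COME NEXT (rows 7, 8, … — any heads, gate inputs, D3 bits, in any number), THE RULE STAYS
UN-FIRED on this ledger: the first report at ten counted rows can read KILL ≥ 1 only if a row typed without a bare «EPH»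
alternative enters the queue (§2). [folklore] -/
theorem ledger0424_kill_false_append (more : List Row) (h : ∀ r ∈ more, [eph] ∈ r.alts) :
    kill thetaOcc (ledger0424 ++ more) = false :=
  kill_false_of_eph_typed thetaOcc _ fun r hr => by
    rcases List.mem_append.1 hr with hr | hr
    · exact ledger0424_eph_typed r hr
    · exact h r hr

/-- The sensitivity of row 6's GAIN to the gate inputs, for the record: at occ 0.911 the gate is open for every θ_occ ≤ 0.911
and shut above; with θ_occ = 0.90 of record the row is GAIN, with a hypothetical θ_occ = 0.92 it would be NEUTRAL (straddle
word both ways) — the row can never be LOSS (§2). [folklore] -/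
theorem rowM334_threshold :
    rowM334.branch 900 = .GAIN ∧ rowM334.branch 911 = .GAIN ∧ rowM334.branch 912 = .NEUTRAL ∧ rowM334.branch 920 = .NEUTRAL
    ∧ (∀ θ, rowM334.branch θ ≠ .LOSS) := by
  refine ⟨by decide, by decide, by decide, by decide, fun θ => ?_⟩
  exact eph_row_never_loss θ rowM334 rfl (Or.inl rfl)

/-! ## §4 (appended 2026-08-29T05:3xZ) ANY exclusion gate that rewrites the located word to bare «EPH» — the sign theorems with
the gate bit free, and the proposed A12 «spin-inert certificate»

The lead's C-MO first pass (cell STATUS 2026-08-29T05:16:51Z, on director-hubbard's «UND-class object» ask) proposes a SECOND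
exclusion gate A12 on located «UND:MIXED+EPH» / «UND:MULTIORB(k; J_H)+EPH» words (FM-start leg collapsed ∧ AF-start leg
collapsed ∧ sub-critical Stoner product ⇒ re-word «EPH(spin-inert …)», an «EPH»-led print with the certificate as payload — the
score reads the leading head, so it is `[eph]`; the arrow-suffix spelling would be uncoded). Nothing in §1–§3 used WHICH gate
opened: the gated word is `if g then [eph] else word065` for a bit `g`. So the letter is the same for every present or future
exclusion gate — no new DISAGREE on a row typing a bare «EPH»; GAIN iff the gate fires on a D3-firing site of an «EPH»-only
row; DISAGREE whenever it fires on a row NONE of whose alternatives is «EPH»-led; PARTIAL when an «EPH»-led alternative with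
riders exists but bare «EPH» does not — and what differs between gates is the CENSUS: over the signed flip table A12's domain
is 160 located MIXED/MULTIORB-class rows, 66 of them typed without bare «EPH» (40 AGREE today: Fe-pnictides k 4–5, RP
nickelates k 2, Sr₂RuO₄, LaNiO₃, Cr/Co/Ni; 21 cuprate U-school PARTIALs incl. §14's M50) — a powered risk arm where A11 had
none (score-2 STATUS 2026-08-29T05:2xZ). -/

/-- The word after an arbitrary exclusion-gate bit `g`: bare «EPH» if it fires, else the located v0.6.5 word. [folklore] -/
def Row.wordG (g : Bool) (r : Row) : List Head := if g then [eph] else r.word065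

/-- A11's v0.7.0 word is the instance `g = gateOpen θ_occ`. [folklore] -/
theorem wordG_gateOpen (θocc : ℕ) (r : Row) : r.wordG (r.gateOpen θocc) = r.word070 θocc := rfl

/-- The cell after the gate. [folklore] -/
def Row.cellG (g : Bool) (r : Row) : Outcome := score (r.wordG g) r.alts

/-- NO NEW DISAGREE UNDER ANY GATE on a row that types a bare «EPH» (§2 with the gate bit free). [folklore] -/
theorem no_newDisagree_anyGate_of_eph_mem (g : Bool) (r : Row) (h : [eph] ∈ r.alts) :
    newDisagreeOf r.cell065 (r.cellG g) = false := by
  unfold newDisagreeOf Row.cellG Row.wordG Row.cell065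
  cases g
  · rw [if_neg Bool.false_ne_true]; generalize score r.word065 r.alts = o; cases o <;> decide
  · rw [if_pos rfl, score_eph_of_mem h]; simp

/-- Under ANY gate an «EPH»-only row is GAIN iff the gate fires and D3 would have fired, else NEUTRAL — never LOSS.
[folklore] -/
theorem eph_row_branch_anyGate (g : Bool) (r : Row) (ha : r.alts = [[eph]]) (hh : r.h = undMixed ∨ r.h = undMultiorb) :
    branchOf r.cell065 (r.cellG g) = (if g && r.fires then .GAIN else .NEUTRAL) := by
  unfold branchOf Row.cell065 Row.cellG Row.wordG Row.word065
  rw [ha]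
  generalize r.fires = f
  rcases hh with hh | hh <;> rw [hh] <;> cases g <;> cases f <;> decide

/-- A FIRING GATE ON A ROW NONE OF WHOSE TYPED ALTERNATIVES IS «EPH»-LED SCORES DISAGREE — whatever else the row carries
(the no-primary floor of G15 §1 applied to the print `[eph]`). This is the whole risk arm of any such gate. [folklore] -/
theorem gate_fire_disagree_of_no_eph_led (r : Row) (hne : r.alts ≠ [])
    (h : ∀ a ∈ r.alts, a.head? ≠ some eph) : r.cellG true = .DISAGREE := by
  unfold Row.cellG Row.wordG; rw [if_pos rfl]
  refine outcome_eq_disagree_of_no_primary_emitted Head.structural hne (by simp [Head.structural]) fun a ha => ?_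
  unfold primaryEmitted
  cases hq : a.head? with
  | none => rfl
  | some q =>
    have hq' : q ≠ eph := fun hqe => h a ha (by rw [hq, hqe])
    simp [hq']

/-- The risk-arm typings of the census under a firing gate, and the two softenings: DISAGREE on «UND:MULTIORB+EPH |
UND:MULTIORB» (Fe-pnictides), «1BH+3BE» (cuprates — §14's M50 and the La-214 six are typed so), «UND:MULTIORB» (Sr₂RuO₄),
«UND:MIXED+EPH | UND:MULTIORB+EPH» (CrAs-HP), «UND:MULTIORB | UND:MULTIORB+EPH» (Cr/Co/Ni, the 1111 ferromagnets); PARTIAL when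
an «EPH»-led alternative with riders is typed without bare «EPH»; and keeping the located head as a RIDER behind «EPH(…)»
softens a d-head typing to PARTIAL but leaves a cuprate typing at DISAGREE unless the A-rule heads ride too. [folklore] -/
theorem gate_fire_typings :
    score [eph] [[undMultiorb, eph], [undMultiorb]] = .DISAGREE ∧ score [eph] [[bh1, be3]] = .DISAGREE
    ∧ score [eph] [[undMultiorb]] = .DISAGREE ∧ score [eph] [[undMixed, eph], [undMultiorb, eph]] = .DISAGREE
    ∧ score [eph] [[undMultiorb], [undMultiorb, eph]] = .DISAGREE
    ∧ score [eph] [[eph, undStruct]] = .PARTIAL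
    ∧ score [eph, undMultiorb] [[undMultiorb, eph], [undMultiorb]] = .PARTIAL
    ∧ score [eph, undMixed] [[bh1, be3]] = .DISAGREE ∧ score [eph, undMixed, bh1, be3] [[bh1, be3]] = .PARTIAL := by
  decide

/-- And on the gain side the form does not matter: «EPH(spin-inert …)» with or without the located head as rider is AGREE on
every typing that lists bare «EPH» (the 94 «EPH»-typed domain rows; 86 PARTIAL today). [folklore] -/
theorem gate_fire_gain_side :
    score [eph] [[eph]] = .AGREE ∧ score [eph, undMixed] [[eph]] = .AGREE ∧ score [eph, undMultiorb] [[eph], [eph, undStruct]] = .AGREE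
    ∧ score [undMixed, eph] [[eph]] = .PARTIAL ∧ score [undMultiorb, eph] [[eph], [eph, undStruct]] = .PARTIAL := by
  decide

end RouterScore

end Summit.Ventures.CertifiedManyBodySolver.Downfold
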